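import Mathlib
import Summits.NavierStokesRegularity.NavierStokesRegularity.Theorems.EulerZoomLiouvillePowerGaugeEulerLiouvilleHoopRidgeRunEnergyCoreUniform
import Summits.NavierStokesRegularity.NavierStokesRegularity.Theorems.EulerZoomLiouvillePowerGaugeEulerLiouvilleHoopLateral
import Summits.NavierStokesRegularity.NavierStokesRegularity.Theorems.EulerZoomLiouvillePowerGaugeEulerLiouvilleHoopRunTools
import Summits.NavierStokesRegularity.NavierStokesRegularity.Theorems.EulerZoomLiouvillePowerGaugeEulerLiouvilleHoopRunFreeDefs
import Summits.NavierStokesRegularity.NavierStokesRegularity.Theorems.EulerZoomLiouvillePowerGaugeEulerLiouvilleHoopCapCost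
import HarnessLib

/-!
# R51 plate t54-LAW, part 2: THE RIDGE-RUN ENERGY LAW for every straight run, from CORE (uniform) + t53-LEL + t51-PIC, and the UNCONDITIONAL law over t54-CC
# (nsreg-p2 ROUND-51 v1.2/v1.3 §2, `RidgeRunEnergyLaw ρ V` text VERBATIM from `r51/TJbare_Q.lean` 8d19af1dedef3daf l.148; seat ns-sfl-p1 g8,
# `--supports stmt-NavierStokesRegularity-19832 --as helper`)

* uses `HoopCore.ridgeRunEnergyCore_uniform` (`…HoopRidgeRunEnergyCoreUniform`: t54-LAW-CORE with `ε₀, R₁` chosen from `(γ, Λ, μ, ν)` alone);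
* `frobeniusNormSq_fderiv_comp_rigid` — `|D(V∘g)(x)|_F² = |DV(g x)|_F²` for `g x = A x + a`, `A` a linear isometry;
* `smul_eZ_sub_apply`, `norm_smul_eZ_sub_sq`, `cylRadius_le_norm_smul_eZ_sub`, `abs_sub_apply_two_le_norm_smul_eZ_sub`, `smul_eZ_mem_solidCyl'` — the moved centre `c′ = A⁻¹(−a)` satisfies
  `cylRadius c′ ≤ ‖σe_Z − c′‖ = ‖A(σe_Z) + a‖` and `|σ − c′₂| ≤ ‖σe_Z − c′‖`;
* ★ `ridgeRunEnergyLaw_of_capCostBound` — `NsregP2.R51.CapCostBound` (t54-CC, HYPOTHESIS by shape, over the tree's `HoopCore.discEnergy` /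
  `HoopCore.discMass`) ⇒ for every `ρ > 0` and every `V`, `RidgeRunEnergyLaw ρ V` (text VERBATIM, unfolded): CORE-uniform for the moved profile
  `(A⁻¹∘V∘g, P′∘g)` with centre `A⁻¹(−a)` (`isSelfSimilarEulerProfile_rigid`, t51-PIC), `hlat` := `HoopCore.lateralHoopInequality` (t53-LEL, p696534),
  `hCC` := the hypothesis, `T₀ ≤ R^{−(1+ρ)} ≤ 1`, the shell clause at the axis points for the two centre bounds, and `|D(A⁻¹∘V∘g)|_F² = |D(V∘g)|_F²`.
* ★★ `ridgeRunEnergyLaw` — THE UNCONDITIONAL LAW `∀ ρ > 0, ∀ V, RidgeRunEnergyLaw ρ V` (text VERBATIM, unfolded): the previous theorem discharged by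
  ns-ezl-w3 g7's t54-CC `HoopCore.capCostBound` (`…HoopCapCost`).

HONEST FRAMING: a class-free law about HYPOTHETICAL `C²` self-similar profiles (no E-TAIL, no (E), no budgets); an instrument for the ridge member /
dust endgame of ROUND-51; by itself it kills no stratum and says nothing about the crux E (19832 OPEN) or NS regularity. [nsreg-p2 R51 §2; folklore]
-/

noncomputable section

set_option linter.dupNamespace false

open MeasureTheory Set Filter Topology Metric Function
open scoped RealInnerProductSpace Topology Interval

namespace Summit.NavierStokesRegularity.NavierStokesRegularity.Theorems.PowerGaugeEulerLiouville

open Literature.Analysis Literature.Analysis.FluidPDE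

namespace HoopCore

/-! ## Rigid motions: the energy density and the moved centre -/

/-- `|D(V∘g)(x)|_F² = |DV(g x)|_F²` for the rigid motion `g x = A x + a` (`A` a linear isometry): `D(V∘g)(x) = DV(g x) ∘ A` and the Frobenius
norm is computed in the orthonormal basis `A eᵢ`. [folklore] -/
theorem frobeniusNormSq_fderiv_comp_rigid (V : EuclideanSpace ℝ (Fin 3) → EuclideanSpace ℝ (Fin 3))
    (A : EuclideanSpace ℝ (Fin 3) ≃ₗᵢ[ℝ] EuclideanSpace ℝ (Fin 3)) (a x : EuclideanSpace ℝ (Fin 3)) :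
    frobeniusNormSq (fderiv ℝ (fun z => V (A z + a)) x) = frobeniusNormSq (fderiv ℝ V (A x + a)) := by
  set M : EuclideanSpace ℝ (Fin 3) ≃L[ℝ] EuclideanSpace ℝ (Fin 3) := A.toContinuousLinearEquiv with hM_def
  have e : (fun z => V (A z + a)) = (fun z => V (z + a)) ∘ ⇑M := by
    funext z; simp only [Function.comp_apply]; rfl
  have hD : fderiv ℝ (fun z => V (A z + a)) x
      = (fderiv ℝ V (A x + a)).comp (M : EuclideanSpace ℝ (Fin 3) →L[ℝ] EuclideanSpace ℝ (Fin 3)) := by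
    rw [e, ContinuousLinearEquiv.comp_right_fderiv, fderiv_comp_add_right]
    rfl
  rw [hD, frobeniusNormSq_eq_sum ((EuclideanSpace.basisFun (Fin 3) ℝ).map A) (fderiv ℝ V (A x + a)),
    frobeniusNormSq_eq_sum (EuclideanSpace.basisFun (Fin 3) ℝ)]
  refine Finset.sum_congr rfl fun i _ => ?_
  simp only [ContinuousLinearMap.comp_apply, OrthonormalBasis.map_apply]
  rfl

/-- Coordinates of `σ e_Z − c`. [folklore] -/
theorem smul_eZ_sub_apply (σ : ℝ) (c : EuclideanSpace ℝ (Fin 3)) :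
    (σ • eZ - c) 0 = -c 0 ∧ (σ • eZ - c) 1 = -c 1 ∧ (σ • eZ - c) 2 = σ - c 2 := by
  refine ⟨?_, ?_, ?_⟩ <;> simp [eZ]

/-- `‖σ e_Z − c‖² = c₀² + c₁² + (σ − c₂)²`. [folklore] -/
theorem norm_smul_eZ_sub_sq (σ : ℝ) (c : EuclideanSpace ℝ (Fin 3)) :
    ‖σ • eZ - c‖ ^ 2 = c 0 ^ 2 + c 1 ^ 2 + (σ - c 2) ^ 2 := by
  obtain ⟨h0, h1, h2⟩ := smul_eZ_sub_apply σ c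
  rw [EuclideanSpace.norm_sq_eq, Fin.sum_univ_three]
  simp only [Real.norm_eq_abs, sq_abs, h0, h1, h2]
  ring

/-- The cylindrical radius of a point is at most its distance to any axis point: `cylRadius c ≤ ‖σ e_Z − c‖`. [folklore] -/
theorem cylRadius_le_norm_smul_eZ_sub (σ : ℝ) (c : EuclideanSpace ℝ (Fin 3)) : cylRadius c ≤ ‖σ • eZ - c‖ := by
  have h : cylRadius c ^ 2 ≤ ‖σ • eZ - c‖ ^ 2 := by
    rw [cylRadius_sq, norm_smul_eZ_sub_sq]; nlinarith [sq_nonneg (σ - c 2)]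
  exact (pow_le_pow_iff_left₀ (cylRadius_nonneg c) (norm_nonneg _) two_ne_zero).1 h

/-- The axial offset is at most the distance: `|σ − c₂| ≤ ‖σ e_Z − c‖`. [folklore] -/
theorem abs_sub_apply_two_le_norm_smul_eZ_sub (σ : ℝ) (c : EuclideanSpace ℝ (Fin 3)) : |σ - c 2| ≤ ‖σ • eZ - c‖ := by
  have h : (σ - c 2) ^ 2 ≤ ‖σ • eZ - c‖ ^ 2 := by
    rw [norm_smul_eZ_sub_sq]; nlinarith [sq_nonneg (c 0), sq_nonneg (c 1)]
  exact abs_le.2 (abs_le_of_sq_le_sq' h (norm_nonneg _))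

/-- The axis point `σ e_Z` lies in `solidCyl s₁ s₂ T₀` for `σ ∈ [s₁, s₂]`, `T₀ ≥ 0` (also `…HoopRunContradiction.smul_eZ_mem_solidCyl`;
restated over lighter imports). [folklore] -/
theorem smul_eZ_mem_solidCyl' {s₁ s₂ T₀ σ : ℝ} (hσ : σ ∈ Icc s₁ s₂) (hT₀ : 0 ≤ T₀) : σ • eZ ∈ solidCyl s₁ s₂ T₀ := by
  have h2 : (σ • (eZ : EuclideanSpace ℝ (Fin 3))) 2 = σ := by simp [eZ]
  have hc : cylRadius (σ • (eZ : EuclideanSpace ℝ (Fin 3))) = 0 := by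
    have h := cylRadius_sq (σ • (eZ : EuclideanSpace ℝ (Fin 3)))
    have h0 : (σ • (eZ : EuclideanSpace ℝ (Fin 3))) 0 = 0 := by simp [eZ]
    have h1 : (σ • (eZ : EuclideanSpace ℝ (Fin 3))) 1 = 0 := by simp [eZ]
    rw [h0, h1] at h
    exact pow_eq_zero_iff two_ne_zero |>.1 (by simpa using h)
  simp only [solidCyl, mem_setOf_eq, h2, hc]
  exact ⟨hσ.1, hσ.2, hT₀⟩

/-! ## The JOIN -/

/-- **RIDGE-RUN ENERGY LAW for every straight run, modulo t54-CC by shape** (`RidgeRunEnergyLaw ρ V` of nsreg-p2 `r51/TJbare_Q.lean`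
8d19af1dedef3daf l.148 VERBATIM, unfolded, for every `ρ > 0`, from the hypothesis `NsregP2.R51.CapCostBound` VERBATIM over
`HoopCore.discEnergy`/`HoopCore.discMass`): for a `C²` self-similar profile `(γ = 1/(2+ρ), 0, V, P′)` and `Λ, μ, ν` with `8ν² + 14γν < Λμ`
there are `ε₀ > 0`, `R₁` such that every straight run `x ↦ Ax + a` of `solidCyl s₁ s₂ T₀` in the shell `R ≤ ‖y‖ ≤ 2R`, `R ≥ R₁`, `R ≥ 1`,
`0 < T₀ ≤ R^{−(1+ρ)}`, `s₂ − s₁ ≥ ΛT₀`, with ridge `μR² ≤ P′(axis) − ⟨P′⟩_θ(σ,T₀)` and wall speed `≤ νR` has `∫_Z |D(V∘g)|_F² ≥ ε₀R²(s₂ − s₁)`.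
Proof: `ridgeRunEnergyCore_uniform` for the moved profile `(A⁻¹∘V∘g, P′∘g)`, centre `A⁻¹(−a)` (t51-PIC `isSelfSimilarEulerProfile_rigid`), with
`hlat := HoopCore.lateralHoopInequality` (t53-LEL) and `hCC :=` the hypothesis. [nsreg-p2 R51 §2; folklore] -/
theorem ridgeRunEnergyLaw_of_capCostBound
    (hCCB : ∀ (γ : ℝ) (c : EuclideanSpace ℝ (Fin 3)) (V : EuclideanSpace ℝ (Fin 3) → EuclideanSpace ℝ (Fin 3)) (σ T₀ w : ℝ), 0 < T₀ → 0 ≤ w → ContDiff ℝ 1 V →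
      (∀ θ : ℝ, ‖V (HoopCore.axisPt σ T₀ θ)‖ ≤ w) →
      HoopCore.endFlux V σ T₀ ≤ 4 * Real.pi * T₀ * w ^ 2 + 2 * T₀ * HoopCore.discEnergy V σ T₀ ∧
      |HoopCore.endTermC γ c V T₀ σ|
      ≤ T₀ * Real.sqrt (2 * (|γ| * |σ - c 2| + w) ^ 2 + HoopCore.discEnergy V σ T₀ / Real.pi)
      * Real.sqrt (2 * w ^ 2 + HoopCore.discEnergy V σ T₀ / Real.pi) ∧
      |HoopCore.offsetTerm γ c V T₀ σ|
      ≤ |γ| * cylRadius c * T₀ * Real.sqrt (2 * w ^ 2 + HoopCore.discEnergy V σ T₀ / Real.pi) ∧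
      |HoopCore.discMass V σ T₀| ≤ T₀ ^ 2 / Real.sqrt 3 * Real.sqrt (2 * w ^ 2 + HoopCore.discEnergy V σ T₀ / Real.pi) ∧
      (∀ t ∈ Ioc 0 T₀,
      |HoopCore.discMass V σ t| ≤ t * Real.sqrt t * Real.sqrt (T₀ / 3) * Real.sqrt (2 * w ^ 2 + HoopCore.discEnergy V σ T₀ / Real.pi))) :
    ∀ (ρ : ℝ) (V : EuclideanSpace ℝ (Fin 3) → EuclideanSpace ℝ (Fin 3)), 0 < ρ →
  ∀ P' : EuclideanSpace ℝ (Fin 3) → ℝ, IsSelfSimilarEulerProfile (1 / (2 + ρ)) 0 V P' →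
    ∀ Λ μ ν : ℝ, 0 < Λ → 0 < μ → 0 ≤ ν → 8 * ν ^ 2 + 14 * (1 / (2 + ρ)) * ν < Λ * μ →
      ∃ ε₀ : ℝ, 0 < ε₀ ∧ ∃ R₁ : ℝ,
        ∀ (A : EuclideanSpace ℝ (Fin 3) ≃ₗᵢ[ℝ] EuclideanSpace ℝ (Fin 3)) (a : EuclideanSpace ℝ (Fin 3)) (R s₁ s₂ T₀ : ℝ),
          R₁ ≤ R → 1 ≤ R → 0 < T₀ → T₀ ≤ R ^ (-(1 + ρ)) → s₁ + Λ * T₀ ≤ s₂ →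
          (∀ x ∈ HoopCore.solidCyl s₁ s₂ T₀, R ≤ ‖A x + a‖ ∧ ‖A x + a‖ ≤ 2 * R) →
          (∀ σ ∈ Icc s₁ s₂,
              μ * R ^ 2 ≤ P' (A (σ • eZ) + a) - HoopCore.circleAvg (fun x => P' (A x + a)) σ T₀ ∧
              ∀ θ : ℝ, ‖V (A (HoopCore.axisPt σ T₀ θ) + a)‖ ≤ ν * R) →
            ε₀ * R ^ 2 * (s₂ - s₁) ≤
              ∫ x in HoopCore.solidCyl s₁ s₂ T₀, frobeniusNormSq (fderiv ℝ (fun z => V (A z + a)) x) := by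
  intro ρ V hρ P' hprof Λ μ ν hΛ hμ hν hc
  have h2ρ : (0 : ℝ) < 2 + ρ := by linarith
  have hγ0 : (0 : ℝ) < 1 / (2 + ρ) := by positivity
  have hγ1 : 1 / (2 + ρ) < (1 : ℝ) := by rw [div_lt_one h2ρ]; linarith
  obtain ⟨ε₀, hε₀, R₁, hcore⟩ := ridgeRunEnergyCore_uniform (1 / (2 + ρ)) Λ μ ν hγ0 hγ1 hΛ hμ hν hc
  refine ⟨ε₀, hε₀, R₁, ?_⟩
  intro A a R s₁ s₂ T₀ hR₁ hR1 hT₀ hT₀b hlen hshell hclauses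
  set c' : EuclideanSpace ℝ (Fin 3) := A.symm (-a) with hc'def
  set V' : EuclideanSpace ℝ (Fin 3) → EuclideanSpace ℝ (Fin 3) := fun y => A.symm (V (A y + a)) with hV'def
  set P'' : EuclideanSpace ℝ (Fin 3) → ℝ := fun y => P' (A y + a) with hP''def
  have hprof' : IsSelfSimilarEulerProfile (1 / (2 + ρ)) c' V' P'' := isSelfSimilarEulerProfile_rigid hprof A a
  have hV1' : ContDiff ℝ 1 V' := hprof'.contDiff_velocity.of_le (by norm_num)
  have hdiv' : ∀ y, VectorCalculus.divergence V' y = 0 := hprof'.divFree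
  have hnV' : ∀ x, ‖V' x‖ = ‖V (A x + a)‖ := fun x => A.symm.norm_map _
  -- the cap costs of the moved field (t54-CC by shape; `discEnergy`/`discMass` unfold definitionally)
  have hCC' : ∀ σ T w : ℝ, 0 < T → 0 ≤ w → (∀ θ : ℝ, ‖V' (axisPt σ T θ)‖ ≤ w) →
      endFlux V' σ T ≤ 4 * Real.pi * T * w ^ 2
          + 2 * T * (∫ z in closedBall (0 : EuclideanSpace ℝ (Fin 2)) T, frobeniusNormSq (fderiv ℝ V' (liftAt σ z))) ∧
      |endTermC (1 / (2 + ρ)) c' V' T σ|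
          ≤ T * Real.sqrt (2 * (|1 / (2 + ρ)| * |σ - c' 2| + w) ^ 2
                + (∫ z in closedBall (0 : EuclideanSpace ℝ (Fin 2)) T, frobeniusNormSq (fderiv ℝ V' (liftAt σ z))) / Real.pi)
            * Real.sqrt (2 * w ^ 2
                + (∫ z in closedBall (0 : EuclideanSpace ℝ (Fin 2)) T, frobeniusNormSq (fderiv ℝ V' (liftAt σ z))) / Real.pi) ∧
      |offsetTerm (1 / (2 + ρ)) c' V' T σ|
          ≤ |1 / (2 + ρ)| * cylRadius c' * T * Real.sqrt (2 * w ^ 2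
                + (∫ z in closedBall (0 : EuclideanSpace ℝ (Fin 2)) T, frobeniusNormSq (fderiv ℝ V' (liftAt σ z))) / Real.pi) ∧
      |∫ t in (0 : ℝ)..T, t * circleAvg (axialVelocity V') σ t|
          ≤ T ^ 2 / Real.sqrt 3 * Real.sqrt (2 * w ^ 2
                + (∫ z in closedBall (0 : EuclideanSpace ℝ (Fin 2)) T, frobeniusNormSq (fderiv ℝ V' (liftAt σ z))) / Real.pi) ∧
      (∀ t ∈ Ioc 0 T,
          |∫ τ in (0 : ℝ)..t, τ * circleAvg (axialVelocity V') σ τ|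
            ≤ t * Real.sqrt t * Real.sqrt (T / 3) * Real.sqrt (2 * w ^ 2
                + (∫ z in closedBall (0 : EuclideanSpace ℝ (Fin 2)) T, frobeniusNormSq (fderiv ℝ V' (liftAt σ z))) / Real.pi)) :=
    fun σ T w hT hw hwall => hCCB (1 / (2 + ρ)) c' V' σ T w hT hw hV1' hwall
  -- the wall radius is at most one
  have hT₁ : T₀ ≤ 1 := hT₀b.trans (Real.rpow_le_one_of_one_le_of_nonpos hR1 (by linarith))
  -- the moved centre: `‖σ e_Z − c′‖ = ‖A(σ e_Z) + a‖ ≤ 2R` at every axis point of the cylinder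
  have hs12 : s₁ ≤ s₂ := by nlinarith
  have hdist : ∀ σ ∈ Icc s₁ s₂, ‖σ • eZ - c'‖ ≤ 2 * R := by
    intro σ hσ
    rw [hc'def, norm_sub_centre_rigid A a (σ • eZ)]
    exact (hshell (σ • eZ) (smul_eZ_mem_solidCyl' hσ hT₀.le)).2
  have hcyl : cylRadius c' ≤ 2 * R :=
    (cylRadius_le_norm_smul_eZ_sub s₁ c').trans (hdist s₁ ⟨le_rfl, hs12⟩)
  have hc2 : ∀ σ ∈ Icc s₁ s₂, |σ - c' 2| ≤ 2 * R :=
    fun σ hσ => (abs_sub_apply_two_le_norm_smul_eZ_sub σ c').trans (hdist σ hσ)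
  -- t53-LEL on every sub-cylinder of the moved field
  have hlat : ∀ σ₁ σ₂ : ℝ, s₁ ≤ σ₁ → σ₁ < σ₂ → σ₂ ≤ s₂ →
      (∫ y in solidCyl σ₁ σ₂ T₀, hoopDensity V' y)
          + 2 * Real.pi * (∫ σ in σ₁..σ₂, circleAvg (fun y => radialVelocity V' y ^ 2) σ T₀)
        ≤ 2 * (∫ y in solidCyl σ₁ σ₂ T₀, frobeniusNormSq (fderiv ℝ V' y))
          + Real.pi * (∫ σ in σ₁..σ₂, (‖V' (σ • eZ)‖ ^ 2 - (axialVelocity V' (σ • eZ)) ^ 2))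
          + endFlux V' σ₁ T₀ + endFlux V' σ₂ T₀ :=
    fun σ₁ σ₂ _ h12 _ => lateralHoopInequality V' σ₁ σ₂ T₀ h12 hT₀ hV1' hdiv'
  -- ridge and wall for the moved pair
  have hridge : ∀ σ ∈ Icc s₁ s₂, μ * R ^ 2 ≤ P'' (σ • eZ) - circleAvg P'' σ T₀ ∧ ∀ θ : ℝ, ‖V' (axisPt σ T₀ θ)‖ ≤ ν * R := by
    intro σ hσ
    refine ⟨(hclauses σ hσ).1, fun θ => ?_⟩
    rw [hnV']
    exact (hclauses σ hσ).2 θ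
  have hmain := hcore c' V' P'' hprof' hCC' R s₁ s₂ T₀ hR₁ hR1 hT₀ hT₁ hlen hcyl hc2 hlat hridge
  -- the energy densities agree
  have hE : ∫ x in solidCyl s₁ s₂ T₀, frobeniusNormSq (fderiv ℝ V' x)
      = ∫ x in solidCyl s₁ s₂ T₀, frobeniusNormSq (fderiv ℝ (fun z => V (A z + a)) x) := by
    refine setIntegral_congr_fun (measurableSet_solidCyl s₁ s₂ T₀) fun x _ => ?_
    rw [hV'def, frobeniusNormSq_fderiv_rigid V A a x, frobeniusNormSq_fderiv_comp_rigid V A a x]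
  rw [hE] at hmain
  exact hmain

/-- ★ **RIDGE-RUN ENERGY LAW** (`RidgeRunEnergyLaw ρ V` of nsreg-p2 `r51/TJbare_Q.lean` 8d19af1dedef3daf l.148 VERBATIM, unfolded; every
`ρ > 0`, every `V`; t54-LAW): `ridgeRunEnergyLaw_of_capCostBound` discharged by ns-ezl-w3 g7's t54-CC `HoopCore.capCostBound`
(`…HoopCapCost`).  Class-free: NET (p695911) + LEL (p696534) + CAP COST (t54-CC) + CUT (p697270) + PIC, no E-TAIL, no (E), no budgets.
[nsreg-p2 R51 §2; folklore] -/
theorem ridgeRunEnergyLaw :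
    ∀ (ρ : ℝ) (V : EuclideanSpace ℝ (Fin 3) → EuclideanSpace ℝ (Fin 3)), 0 < ρ →
  ∀ P' : EuclideanSpace ℝ (Fin 3) → ℝ, IsSelfSimilarEulerProfile (1 / (2 + ρ)) 0 V P' →
    ∀ Λ μ ν : ℝ, 0 < Λ → 0 < μ → 0 ≤ ν → 8 * ν ^ 2 + 14 * (1 / (2 + ρ)) * ν < Λ * μ →
      ∃ ε₀ : ℝ, 0 < ε₀ ∧ ∃ R₁ : ℝ,
        ∀ (A : EuclideanSpace ℝ (Fin 3) ≃ₗᵢ[ℝ] EuclideanSpace ℝ (Fin 3)) (a : EuclideanSpace ℝ (Fin 3)) (R s₁ s₂ T₀ : ℝ),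
          R₁ ≤ R → 1 ≤ R → 0 < T₀ → T₀ ≤ R ^ (-(1 + ρ)) → s₁ + Λ * T₀ ≤ s₂ →
          (∀ x ∈ HoopCore.solidCyl s₁ s₂ T₀, R ≤ ‖A x + a‖ ∧ ‖A x + a‖ ≤ 2 * R) →
          (∀ σ ∈ Icc s₁ s₂,
              μ * R ^ 2 ≤ P' (A (σ • eZ) + a) - HoopCore.circleAvg (fun x => P' (A x + a)) σ T₀ ∧
              ∀ θ : ℝ, ‖V (A (HoopCore.axisPt σ T₀ θ) + a)‖ ≤ ν * R) →
            ε₀ * R ^ 2 * (s₂ - s₁) ≤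
              ∫ x in HoopCore.solidCyl s₁ s₂ T₀, frobeniusNormSq (fderiv ℝ (fun z => V (A z + a)) x) :=
  ridgeRunEnergyLaw_of_capCostBound capCostBound

end HoopCore

end Summit.NavierStokesRegularity.NavierStokesRegularity.Theorems.PowerGaugeEulerLiouville

end
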